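import Mathlib
import HarnessLib
import Summits.NavierStokesRegularity.NavierStokesRegularity.Theorems.LocalIrrotationalScarDoorZoomTopRegularity
import Summits.NavierStokesRegularity.NavierStokesRegularity.Theorems.LocalIrrotationalScarDoorZoomTraceTools

/-!
# STAGED door S15 `LocalIrrotationalScarDoor` (nsreg-p1 ROUND-14), zoom crux `K1Rep` (`LocalPointZoomScarCurlRep`) —
# support tools, part 5: the TOP TRACE of the zooms on the side and the LINEAR RATE of their vorticity

Step (iii-c) of the `K1Rep` plan (ROUND-14 §4 Day 2).  On the side `S` (open, dilation invariant) where the final-time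
velocity trace `u(t,·) → u(T,·)` exists pointwise, `u(T,·) ∈ C¹` and `curl u(T,·) = 0`, each zoom
`Zⱼ = (μⱼ/ν)•u(T + μⱼ²·/ν, x₀ + μⱼ·)` (a classical unit-viscosity solution for `s < 0` with uniform `C³` bounds near the
top away from the axis, part 4) satisfies:

* `taylor_bound_of_iteratedFDeriv_two` — generic: `‖D²f‖ ≤ K` on a ball gives the first-order Taylor bound
  `‖f(y+h) − f(y) − Df(y)h‖ ≤ K‖h‖²`;
* `zoom_top_curl_tendsto_zero` — `curl Zⱼ(σ)(y) → 0` as `σ ↑ 0` for `y` on the side (derivatives of the pointwise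
  limit `Zⱼ(σ,·) → Zⱼ(0,·) = (μⱼ/ν) u(T, x₀ + μⱼ·)`, `…ZoomTraceTools.tendsto_fderiv_of_tendsto_of_taylor`);
* `zoom_top_curl_rate` — hence `‖curl Zⱼ(s)(y)‖ ≤ K′(−s)` on `]−(r₀/2)², 0[ × B(x, r₀/4)`, ONE `K′` for all large `j`
  (`…ZoomTraceTools.norm_le_mul_of_deriv_bound_of_tendsto_zero` with part 4's derivative bound).

Seat nsreg-p6 g7; helper toward the S15 zoom crux (anchor `--supports stmt-NavierStokesRegularity-11719`).
WHAT THIS IS NOT: not NS regularity; not yet `K1Rep` (assembled in the sequel from `…ZoomData`-type data + this rate).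
-/

noncomputable section

open MeasureTheory Set Function Filter Topology TopologicalSpace Metric
open Literature.Analysis Literature.Analysis.FluidPDE Literature.Analysis.FluidPDE.SereginSverak2009
open Summit.NavierStokesRegularity.NavierStokesRegularity.Theorems
open Summit.NavierStokesRegularity.NavierStokesRegularity.Theorems.LocalIrrotationalScarDoorZoomApex
open Summit.NavierStokesRegularity.NavierStokesRegularity.Theorems.LocalIrrotationalScarDoorZoomDataTop
open Summit.NavierStokesRegularity.NavierStokesRegularity.Theorems.LocalIrrotationalScarDoorZoomTopRegularity
open Summit.NavierStokesRegularity.NavierStokesRegularity.Theorems.LocalIrrotationalScarDoorZoomTraceTools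
open scoped NNReal ENNReal

-- the summit and its single sub-problem share the name (CONVENTIONS §1), as in every Theorems file
set_option linter.dupNamespace false

namespace Summit.NavierStokesRegularity.NavierStokesRegularity.Theorems.LocalIrrotationalScarDoorZoomTopFading

/-- **First-order Taylor bound from a bound on the second derivative** on a ball: if `f` is `C²` at every point of
`B(y, r)` with `‖D²f‖ ≤ K` there, then `‖f(y+h) − f(y) − Df(y)h‖ ≤ K‖h‖²` for `‖h‖ < r`. [folklore] -/
theorem taylor_bound_of_iteratedFDeriv_two {E F : Type*} [NormedAddCommGroup E] [NormedSpace ℝ E]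
    [NormedAddCommGroup F] [NormedSpace ℝ F] {f : E → F} {y : E} {r K : ℝ}
    (hf : ∀ z ∈ ball y r, ContDiffAt ℝ 2 f z) (hK : ∀ z ∈ ball y r, ‖iteratedFDeriv ℝ 2 f z‖ ≤ K)
    {h : E} (hh : ‖h‖ < r) : ‖f (y + h) - f y - fderiv ℝ f y h‖ ≤ K * ‖h‖ ^ 2 := by
  have hd : ∀ z ∈ ball y r, DifferentiableAt ℝ f z := fun z hz => (hf z hz).differentiableAt (by simp)
  have hd2 : ∀ z ∈ ball y r, DifferentiableAt ℝ (fderiv ℝ f) z := fun z hz =>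
    ((hf z hz).fderiv_right (m := 1) (by norm_num)).differentiableAt one_ne_zero
  have hK' : ∀ z ∈ ball y r, ‖fderiv ℝ (fderiv ℝ f) z‖ ≤ K := by
    intro z hz
    rw [← norm_iteratedFDeriv_zero (𝕜 := ℝ) (f := fderiv ℝ (fderiv ℝ f)), norm_iteratedFDeriv_fderiv,
      norm_iteratedFDeriv_fderiv]
    exact hK z hz
  -- (1) the gradient is `K`-Lipschitz on the ball
  have hr : 0 < r := lt_of_le_of_lt (norm_nonneg h) hh
  have hsub : closedBall y ‖h‖ ⊆ ball y r := closedBall_subset_ball hh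
  have hK0 : 0 ≤ K := (norm_nonneg _).trans (hK y (mem_ball_self hr))
  have hlip : ∀ z ∈ closedBall y ‖h‖, ‖fderiv ℝ f z - fderiv ℝ f y‖ ≤ K * ‖h‖ := by
    intro z hz
    have h1 := (convex_ball y r).norm_image_sub_le_of_norm_fderiv_le hd2 hK' (mem_ball_self hr) (hsub hz)
    calc ‖fderiv ℝ f z - fderiv ℝ f y‖ ≤ K * ‖z - y‖ := h1
      _ ≤ K * ‖h‖ := mul_le_mul_of_nonneg_left (mem_closedBall_iff_norm.1 hz) hK0
  -- (2) mean value for `φ(z) = f z - Df(y) z` on the closed ball of radius `‖h‖`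
  set φ : E → F := fun z => f z - fderiv ℝ f y z with hφ
  have hφd : ∀ z ∈ closedBall y ‖h‖, DifferentiableAt ℝ φ z := fun z hz =>
    (hd z (hsub hz)).sub ((fderiv ℝ f y).differentiableAt)
  have hφ' : ∀ z ∈ closedBall y ‖h‖, ‖fderiv ℝ φ z‖ ≤ K * ‖h‖ := by
    intro z hz
    have e : fderiv ℝ φ z = fderiv ℝ f z - fderiv ℝ f y :=
      ((hd z (hsub hz)).hasFDerivAt.sub (fderiv ℝ f y).hasFDerivAt).fderiv
    rw [e]; exact hlip z hz
  have hmv := (convex_closedBall y ‖h‖).norm_image_sub_le_of_norm_fderiv_le hφd hφ'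
    (mem_closedBall_self (norm_nonneg h)) (by simp [mem_closedBall, dist_eq_norm] : y + h ∈ closedBall y ‖h‖)
  have e2 : φ (y + h) - φ y = f (y + h) - f y - fderiv ℝ f y h := by
    simp only [hφ, map_add]; abel
  rw [e2, add_sub_cancel_left] at hmv
  calc ‖f (y + h) - f y - fderiv ℝ f y h‖ ≤ K * ‖h‖ * ‖h‖ := hmv
    _ = K * ‖h‖ ^ 2 := by ring

variable {ν T : ℝ} {u : ℝ → EuclideanSpace ℝ (Fin 3) → EuclideanSpace ℝ (Fin 3)}
  {p : ℝ → EuclideanSpace ℝ (Fin 3) → ℝ} {x₀ : EuclideanSpace ℝ (Fin 3)} {ρ M R : ℝ}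
  {v' : ℝ → EuclideanSpace ℝ (Fin 3) → EuclideanSpace ℝ (Fin 3)} {π' : ℝ → EuclideanSpace ℝ (Fin 3) → ℝ}
  {lam : ℕ → ℝ} {Ks : ℝ≥0} {r₁ : ℝ} {x : EuclideanSpace ℝ (Fin 3)} {r₀ : ℝ} {S : Set (EuclideanSpace ℝ (Fin 3))}

set_option maxHeartbeats 800000 in
/-- **Linear rate of the zoomed vorticity at the top, on the side** (see the module docstring): one constant `K′`
such that for all large `j`, all `s ∈ ]−(r₀/2)², 0[` and all `y ∈ B(x, r₀/4)`,
`‖curl Zⱼ(s)(y)‖ ≤ K′(−s)`, where `B(x, r₀) ⊆ S`, `0 < r₀ ≤ ‖x‖/2`. -/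
theorem zoom_top_curl_rate (hν : 0 < ν) (hT : 0 < T) (hsol : IsClassicalNSSolutionOn (Ico 0 T) ν 0 u p)
    (hρ : 0 < ρ)
    (hM : ∀ t ∈ Ico 0 T, T - ρ ^ 2 < t → ∀ x ∈ ball x₀ ρ,
      ‖u t x‖ * (‖x - x₀‖ + Real.sqrt (ν * (T - t))) ≤ M)
    (hR : 0 < R) (hball1 : IsSuitableWeakSolutionInBall 1 0 v' π') (hlam : ∀ j, 0 < lam j)
    (hlam0 : Tendsto lam atTop (𝓝 0)) (hr₁ : 0 < r₁) (hr₁1 : r₁ ≤ 1)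
    (hKs : ∀ r ∈ Ioc (0 : ℝ) r₁, cknD r (0 : ℝ × EuclideanSpace ℝ (Fin 3)) π' ≤ Ks)
    (hpt : ∀ (j : ℕ) (s : ℝ) (y : EuclideanSpace ℝ (Fin 3)),
      ((lam j) • stPull ((lam j) ^ 2) (lam j) (0 : ℝ) (0 : EuclideanSpace ℝ (Fin 3)) v') s y =
        ((R * (lam j / 2)) / ν) • u (T + (R * (lam j / 2)) ^ 2 * s / ν) (x₀ + (R * (lam j / 2)) • y))
    (hSdil : ∀ y ∈ S, ∀ c : ℝ, 0 < c → c • y ∈ S) (hxS : ball x r₀ ⊆ S) (hr₀ : 0 < r₀) (hr₀x : r₀ ≤ ‖x‖ / 2)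
    (htrace : ∀ x' ∈ ball x₀ ρ, x' - x₀ ∈ S → Tendsto (fun t => u t x') (𝓝[<] T) (𝓝 (u T x')))
    (hC1 : ContDiffOn ℝ 1 (u T) (ball x₀ ρ ∩ {x' | x' - x₀ ∈ S})) (hS : IsOpen S)
    (hcurl0 : ∀ x' ∈ ball x₀ ρ, x' - x₀ ∈ S → curl (u T) x' = 0) :
    ∃ (J : ℕ) (K' : ℝ), 0 ≤ K' ∧ ∀ j, J ≤ j → ∀ s ∈ Ioo (-(r₀ / 2) ^ 2) 0, ∀ y ∈ ball x (r₀ / 4),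
      ‖curl ((((R * (lam j / 2)) / ν) • stPull ((R * (lam j / 2)) ^ 2 / ν) (R * (lam j / 2)) T x₀ u) s) y‖ ≤
        K' * (-s) := by
  have hΛpos : ∀ j, 0 < (R * (lam j / 2)) := fun j => mul_pos hR (half_pos (hlam j))
  have hΛ0 : Tendsto (fun j => (R * (lam j / 2))) atTop (𝓝 0) := by
    simpa using (hlam0.div_const 2).const_mul R
  obtain ⟨JA, K, hK0, hK⟩ := zoom_top_uniform_bounds hν hT hsol hρ hM hR hball1 hlam hlam0 hr₁ hr₁1 hKs hpt hr₀ hr₀x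
  obtain ⟨JB, K', hK'0, hB⟩ :=
    zoom_top_curl_hasDerivAt_bound hν hT hsol hρ hM hR hball1 hlam hlam0 hr₁ hr₁1 hKs hpt hr₀ hr₀x
  -- thresholds: zoomed side points lie in `B(x₀, ρ)`, zoomed times in `[0, T)`
  set a : ℝ := 2 * ‖x‖ + 2 with ha_def
  have ha : 0 < a := by positivity
  obtain ⟨JC, hJC⟩ := eventually_atTop.1 (eventually_zoom_region (x₀ := x₀) hν hT hρ hΛpos hΛ0 ha)
  refine ⟨max (max JA JB) JC, K', hK'0, fun j hj s hs y hy => ?_⟩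
  have hjA : JA ≤ j := ((le_max_left _ _).trans (le_max_left _ _)).trans hj
  have hjB : JB ≤ j := ((le_max_right _ _).trans (le_max_left _ _)).trans hj
  have hjC : JC ≤ j := (le_max_right _ _).trans hj
  set μ : ℝ := R * (lam j / 2) with hμ
  have hμpos : 0 < μ := hΛpos j
  set Zu : ℝ → EuclideanSpace ℝ (Fin 3) → EuclideanSpace ℝ (Fin 3) :=
    (μ / ν) • stPull (μ ^ 2 / ν) μ T x₀ u with hZu
  have hZeq : ((lam j) • stPull ((lam j) ^ 2) (lam j) (0 : ℝ) (0 : EuclideanSpace ℝ (Fin 3)) v') = Zu := by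
    funext σ y'
    rw [hpt j σ y', hZu, smul_stPull_apply]
    congr 2
    ring
  -- geometry: `B(y, r₀/4) ⊆ B(x, r₀/2) ⊆ B(x, r₀) ⊆ S ∩ Q(0,a)`-slices
  have hyx : dist y x < r₀ / 4 := mem_ball.1 hy
  have hball_sub : ∀ y' ∈ ball y (r₀ / 4), dist y' x < r₀ / 2 := fun y' hy' => by
    calc dist y' x ≤ dist y' y + dist y x := dist_triangle _ _ _
      _ < r₀ / 4 + r₀ / 4 := add_lt_add (mem_ball.1 hy') hyx
      _ = r₀ / 2 := by ring
  have hmemQ : ∀ σ ∈ Ioo (-(r₀ / 2) ^ 2) 0, ∀ y' ∈ ball y (r₀ / 4), ((σ, y') : ℝ × EuclideanSpace ℝ (Fin 3)) ∈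
      parabolicCylinder (r₀ / 2) (((0 : ℝ), x) : ℝ × EuclideanSpace ℝ (Fin 3)) := fun σ hσ y' hy' => by
    rw [mem_parabolicCylinder_top_iff]; exact ⟨hσ, hball_sub y' hy'⟩
  have hmemQa : ∀ σ ∈ Ioo (-(r₀ / 2) ^ 2) 0, ∀ y' ∈ ball y (r₀ / 4), ((σ, y') : ℝ × EuclideanSpace ℝ (Fin 3)) ∈
      parabolicCylinder a (0 : ℝ × EuclideanSpace ℝ (Fin 3)) := fun σ hσ y' hy' => by
    rw [SuitableCompactness.mem_parabolicCylinder_zero]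
    have h1 : (r₀ / 2) ^ 2 < a ^ 2 := by
      have : r₀ / 2 < a := by rw [ha_def]; linarith [norm_nonneg x]
      nlinarith
    refine ⟨⟨by linarith [hσ.1], hσ.2⟩, ?_⟩
    calc ‖y'‖ ≤ dist y' x + ‖x‖ := by simpa [dist_zero_right] using dist_triangle y' x 0
      _ < a := by rw [ha_def]; linarith [norm_nonneg x, hball_sub y' hy']
  -- side points: `x₀ + μ y' ∈ B(x₀, ρ)` and `μ y' ∈ S` for `y' ∈ B(y, r₀/4)` (also at the top time)
  have hside : ∀ y' ∈ ball y (r₀ / 4), x₀ + μ • y' ∈ ball x₀ ρ ∧ x₀ + μ • y' - x₀ ∈ S := by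
    intro y' hy'
    have hneg : (-(r₀ / 2) ^ 2 / 2 : ℝ) ∈ Ioo (-(r₀ / 2) ^ 2) 0 :=
      ⟨by nlinarith [pow_pos (half_pos hr₀) 2], by
        have := pow_pos (half_pos hr₀) 2; linarith⟩
    have h := (hJC j hjC _ (hmemQa _ hneg y' hy')).2.2
    refine ⟨h, ?_⟩
    rw [add_sub_cancel_left]
    exact hSdil y' (hxS (mem_ball.2 ((hball_sub y' hy').trans (by linarith)))) μ hμpos
  -- ## the top trace of the zoom: `curl Zu(σ)(y) → 0` as `σ ↑ 0`
  have htop : Tendsto (fun σ => curl (Zu σ) y) (𝓝[<] 0) (𝓝 0) := by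
    -- time change `σ ↦ T + (μ²/ν) σ`
    have hτ : Tendsto (fun σ : ℝ => T + μ ^ 2 / ν * σ) (𝓝[<] 0) (𝓝[<] T) := by
      have hc : ContinuousWithinAt (fun σ : ℝ => T + μ ^ 2 / ν * σ) (Iio 0) 0 :=
        (by fun_prop : Continuous fun σ : ℝ => T + μ ^ 2 / ν * σ).continuousWithinAt
      have hmaps : MapsTo (fun σ : ℝ => T + μ ^ 2 / ν * σ) (Iio 0) (Iio T) := fun σ hσ => by
        show T + μ ^ 2 / ν * σ < T
        have : μ ^ 2 / ν * σ < 0 := mul_neg_of_pos_of_neg (by positivity) hσ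
        linarith
      have h := hc.tendsto_nhdsWithin hmaps
      simpa using h
    -- (hlim) pointwise convergence of the zooms on `B(y, r₀/4)`
    have hlim : ∀ y' ∈ ball y (r₀ / 4), Tendsto (fun σ => Zu σ y') (𝓝[<] 0) (𝓝 (Zu 0 y')) := by
      intro y' hy'
      obtain ⟨hX, hXS⟩ := hside y' hy'
      have h := ((htrace _ hX hXS).comp hτ).const_smul (μ / ν)
      have e0 : Zu 0 y' = (μ / ν) • u T (x₀ + μ • y') := by
        simp only [hZu, smul_stPull_apply, mul_zero, add_zero]
      rw [e0]
      refine h.congr fun σ => ?_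
      simp only [hZu, smul_stPull_apply, Function.comp_apply]
    -- (htaylor) uniform Taylor bound from the `C²` bound `K`
    have htaylor : ∀ᶠ σ in 𝓝[<] (0 : ℝ), ∀ h : EuclideanSpace ℝ (Fin 3), ‖h‖ < r₀ / 4 →
        ‖Zu σ (y + h) - Zu σ y - fderiv ℝ (Zu σ) y h‖ ≤ K * ‖h‖ ^ 2 := by
      have hlt : (-(r₀ / 2) ^ 2 : ℝ) < 0 := by have := pow_pos (half_pos hr₀) 2; linarith
      filter_upwards [Ioo_mem_nhdsLT hlt] with σ hσ h hh
      refine taylor_bound_of_iteratedFDeriv_two (fun z hz => ?_) (fun z hz => ?_) hh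
      · -- smoothness of the slice `Zu σ` (classical solution at the zoomed time)
        have ht : T + μ ^ 2 * σ / ν ∈ Ico 0 T := (hJC j hjC _ (hmemQa σ hσ z hz)).1
        have hu : ContDiff ℝ 2 (u (T + μ ^ 2 * σ / ν)) := (hsol.contDiff_velocity ht).of_le (by norm_cast)
        have e : Zu σ = fun y' => (μ / ν) • u (T + μ ^ 2 * σ / ν) (x₀ + μ • y') := by
          funext y'; simp only [hZu, smul_stPull_apply]; congr 2; ring
        rw [e]
        exact ((hu.comp ((contDiff_const.add (contDiff_id.const_smul μ)))).const_smul (μ / ν)).contDiffAt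
      · have hb := hK j hjA (σ, z) (hmemQ σ hσ z hz) 2 (by norm_num)
        rwa [hZeq] at hb
    -- (hg) differentiability of the top trace `Zu 0 = (μ/ν) u(T, x₀ + μ·)` at `y`
    have hg : DifferentiableAt ℝ (Zu 0) y := by
      obtain ⟨hX, hXS⟩ := hside y (mem_ball_self (by positivity))
      have hU : IsOpen (ball x₀ ρ ∩ {x' | x' - x₀ ∈ S}) :=
        isOpen_ball.inter (hS.preimage (continuous_id.sub continuous_const))
      have hdT : DifferentiableAt ℝ (u T) (x₀ + μ • y) :=
        (hC1.differentiableOn one_ne_zero).differentiableAt (hU.mem_nhds ⟨hX, hXS⟩)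
      have e : Zu 0 = fun y' => (μ / ν) • u T (x₀ + μ • y') := by
        funext y'; simp only [hZu, smul_stPull_apply, mul_zero, add_zero]
      rw [e]
      exact ((hdT.comp y ((differentiableAt_const _).add (differentiableAt_id.const_smul μ)))).const_smul (μ / ν)
    have hD := tendsto_fderiv_of_tendsto_of_taylor (by positivity : (0 : ℝ) < r₀ / 4) hlim htaylor hg
    -- `curl Zu(0)(y) = (μ²/ν) curl u(T)(x₀ + μ y) = 0`
    have hc := (curlCLM.continuous.tendsto _).comp hD
    have e1 : curl (Zu 0) y = 0 := by
      obtain ⟨hX, hXS⟩ := hside y (mem_ball_self (by positivity))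
      rw [hZu, FluidPDE.curl_smul_stPull, mul_zero, add_zero, hcurl0 _ hX hXS, smul_zero]
    rw [show (fun σ => curl (Zu σ) y) = fun σ => curlCLM (fderiv ℝ (Zu σ) y) from
      funext fun σ => curl_eq_curlCLM _ _]
    rw [curl_eq_curlCLM] at e1
    simpa [Function.comp_def, e1] using hc
  -- ## the rate, from the derivative bound (part 4) and the top trace
  have hmem : ((s, y) : ℝ × EuclideanSpace ℝ (Fin 3)) ∈
      parabolicCylinder (r₀ / 2) (((0 : ℝ), x) : ℝ × EuclideanSpace ℝ (Fin 3)) := hmemQ s hs y (mem_ball_self (by positivity))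
  have hderiv : ∀ σ ∈ Ioo (-(r₀ / 2) ^ 2) 0,
      HasDerivAt (fun σ => curl (Zu σ) y) (deriv (fun σ => curl (Zu σ) y) σ) σ := by
    intro σ hσ
    obtain ⟨D, hD, -⟩ := hB j hjB (σ, y) (hmemQ σ hσ y (mem_ball_self (by positivity)))
    exact hD.differentiableAt.hasDerivAt
  have hbound : ∀ σ ∈ Ioo (-(r₀ / 2) ^ 2) 0, ‖deriv (fun σ => curl (Zu σ) y) σ‖ ≤ K' := by
    intro σ hσ
    obtain ⟨D, hD, hDK⟩ := hB j hjB (σ, y) (hmemQ σ hσ y (mem_ball_self (by positivity)))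
    rw [hD.deriv]; exact hDK
  exact norm_le_mul_of_deriv_bound_of_tendsto_zero hderiv hbound htop hs

end Summit.NavierStokesRegularity.NavierStokesRegularity.Theorems.LocalIrrotationalScarDoorZoomTopFading

end
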